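import Summits.BirchSwinnertonDyer.BirchSwinnertonDyer.Theorems.SylvesterTwoHeegnerIndexCoupledTelescopeStep
import Mathlib.Tactic.Module
import HarnessLib

/-!
# The COUPLED Cassels–Tate telescope, VI: LIFTS — exact-order `𝒪`-lifts of a quotient basis and the
# transfer of `𝒪`-independence (the algebra behind the telescope's `hN/hN'/hind` inputs)

Companion of `…Theorems.SylvesterTwoHeegnerIndexCoupledTelescope{Step,,Selmer,Count,TailFour,TailSeven}`
(crux `UpperOffV0HSYPlus`, stmt-BirchSwinnertonDyer-19804, VARIANT M stubs `stub_tailFour` /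
`stub_tailSeven`).  The census theorems display, among the TAIL's leaves, a family of LIFTS
`s_X i ∈ Sel_{2^M}(X_K/K)` of exact orders `2^{N i}`, `𝒪`-independent (together with the bottom class
`x` on `B`), whose images span a coisotropic `D_X ≤ Ш(X_K)[2^∞]`.  McCallum (p. 288) obtains them by
«choose a maximal isotropic subgroup `D = D₁ × D₂ × ⋯` of `Ш = Sel/ℤx` and lift its generators»; the
algebraic facts that make the lifts as good as the generators are proved here ABSTRACTLY (any additive
groups `S`, `Q`, any additive `π : S → Q` killing `x` and `w x`, a prime power `p^M` killing `S`, the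
`𝒪`-structure through additive operators `w` on `S` and `w'` on `Q` with `π ∘ w = w' ∘ π`):

* `exists_lift_pow_smul_eq_zero` — **exact-order lifts** (McCallum p. 288 «lift `d_i` to `c_i ∈ Sel`
  of the same order»): if `ker π ⊆ 𝒪·x = {a x + b w x}` and `𝒪·x ≅ 𝒪/p^M` (`a x + b w x = 0 ⟹
  p^M ∣ a, b`), then every `d = π s₀` with `p^N d = 0`, `N ≤ M`, has a lift `s` with `π s = d` AND
  `p^N s = 0` (the defect `p^N s₀ = a x + b w x` has `p^N ∣ a, b` because `p^M s₀ = 0`).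
* `indep_of_indep_image` — **transfer of `𝒪`-independence**: if the images `π (s i)` are
  `𝒪`-independent with exact annihilators `p^{N i}𝒪`
  (`∑ (α_i π s_i + β_i w' π s_i) = 0 ⟹ p^{N_i} ∣ α_i, β_i`) and `p^{N_i} s_i = 0`, then `x, (s_i)`
  satisfy the telescope's independence clause `hindB` (`(b x + c w x) + ∑ (α_i s_i + β_i w s_i) = 0 ⟹`
  every term vanishes); `indep_of_indep_image'` is the `x`-free form (`hindA`);
  `pow_sub_one_smul_ne_zero_of_indep_image` is the exactness clause `hN'`.
* `indep_image_of_descent` — the `𝒪`-independence-with-exact-annihilators of the `d_i` from a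
  `ℤ`-INDEPENDENT exact-order family `d_i` in a subgroup `D₀ ≤ Q` on which `(a, b) ↦ a + w' b` is
  injective (LEMMA K0 / LEMMA D descent `D₀ ⊔ w'·D₀ ≅ D₀ ⊗ 𝒪`, memo two §57.1/§59.1 (iii), k-ty1/g19
  `exists_descent_bijective`) — so a `ℤ`-basis of a Lagrangian `D₀` of `Ш(X/ℚ)[2^∞]` feeds the census.

Theorem-only (no definition, no named fact); pure algebra; nothing asserted on 19804; BSD not claimed.
Sources: McCallum 1991 (LMS LN 153) §5, p. 288; MEMO-bsd-cm-two §59.1 (iii), §64.5 SET-UP.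
-/

-- every Summits module is named `Summit.<Summit>.<Problem>…`: the duplicated component is by design
set_option linter.dupNamespace false
set_option autoImplicit false

open scoped Classical

namespace Summit.BirchSwinnertonDyer.BirchSwinnertonDyer.Theorems.SylvesterTwoCoupledTelescope

section Lifts

variable {S Q : Type*} [AddCommGroup S] [AddCommGroup Q]

/-- **Exact-order lifts** (McCallum 1991, p. 288: the generators `d_i` of `D ⊆ Ш(E/K)_{p^M} = Sel/ℤx`
lift to `c_i ∈ Sel` of the same order; `𝒪`-form).  `π : S → Q` additive with `π x = π (w x) = 0` and
`ker π ⊆ 𝒪·x`, `𝒪·x ≅ 𝒪/p^M` (`a x + b w x = 0 ⟹ p^M ∣ a ∧ p^M ∣ b`), `p^M S = 0`: every `π s₀`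
killed by `p^N`, `N ≤ M`, has a lift killed by `p^N`. [cite: McCallumLMS1991, §5 (p. 288)] -/
theorem exists_lift_pow_smul_eq_zero {p : ℕ} (hp : p ≠ 0) {M : ℕ} (π : S →+ Q) (w : S →+ S) (x : S)
    (hπx : π x = 0) (hπw : π (w x) = 0)
    (hker : ∀ s, π s = 0 → ∃ a b : ℤ, s = a • x + b • w x)
    (hx : ∀ a b : ℤ, a • x + b • w x = 0 → ((p : ℤ) ^ M) ∣ a ∧ ((p : ℤ) ^ M) ∣ b)
    (htors : ∀ s : S, ((p : ℤ) ^ M) • s = 0) {N : ℕ} (hN : N ≤ M) (s₀ : S)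
    (hd : ((p : ℤ) ^ N) • π s₀ = 0) :
    ∃ s : S, π s = π s₀ ∧ ((p : ℤ) ^ N) • s = 0 := by
  obtain ⟨a, b, hab⟩ := hker (((p : ℤ) ^ N) • s₀) (by rw [map_zsmul, hd])
  -- `p^M s₀ = 0` forces `p^N ∣ a, b`
  have hpow : (p : ℤ) ^ M = (p : ℤ) ^ (M - N) * (p : ℤ) ^ N := by
    rw [← pow_add, Nat.sub_add_cancel hN]
  have hdiv : ((p : ℤ) ^ M) ∣ (p : ℤ) ^ (M - N) * a ∧ ((p : ℤ) ^ M) ∣ (p : ℤ) ^ (M - N) * b := by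
    apply hx
    rw [mul_smul, mul_smul, ← smul_add, ← hab, smul_smul, ← hpow, htors]
  rw [hpow] at hdiv
  have hp' : (p : ℤ) ^ (M - N) ≠ 0 := pow_ne_zero _ (by exact_mod_cast hp)
  obtain ⟨⟨a', ha'⟩, ⟨b', hb'⟩⟩ := hdiv
  have ha : a = (p : ℤ) ^ N * a' := mul_left_cancel₀ hp' (by rw [ha', mul_assoc])
  have hb : b = (p : ℤ) ^ N * b' := mul_left_cancel₀ hp' (by rw [hb', mul_assoc])
  refine ⟨s₀ - a' • x - b' • w x, by rw [map_sub, map_sub, map_zsmul, map_zsmul, hπx, hπw,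
    smul_zero, smul_zero, sub_zero, sub_zero], ?_⟩
  rw [smul_sub, smul_sub, hab, ha, hb]
  module

/-- A scalar divisible by `p^N` kills an element killed by `p^N` (and its `w`-image). [folklore] -/
theorem zsmul_add_zsmul_eq_zero_of_dvd {p : ℕ} {N : ℕ} (w : S →+ S) {s : S}
    (hs : ((p : ℤ) ^ N) • s = 0) {α β : ℤ} (hα : ((p : ℤ) ^ N) ∣ α) (hβ : ((p : ℤ) ^ N) ∣ β) :
    α • s + β • w s = 0 := by
  obtain ⟨a, rfl⟩ := hα
  obtain ⟨b, rfl⟩ := hβ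
  rw [mul_comm _ a, mul_comm _ b, mul_smul, mul_smul, hs, ← map_zsmul, hs, smul_zero, map_zero,
    smul_zero, add_zero]

/-- **Transfer of `𝒪`-independence from the images (with the bottom class `x`)** — the telescope's
`hindB`: if `π x = π (w x) = 0`, `π ∘ w = w' ∘ π`, the images `π (s i)` (`i ∈ I`) are `𝒪`-independent
with exact annihilators `p^{N i}` and `p^{N i} s_i = 0`, then
`(b x + c w x) + ∑ (α_i s_i + β_i w s_i) = 0` forces every term to vanish.
[cite: McCallumLMS1991, §5 (p. 288)] -/
theorem indep_of_indep_image {p : ℕ} (π : S →+ Q) (w : S →+ S) (w' : Q →+ Q)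
    (hπw : ∀ s, π (w s) = w' (π s)) (x : S) (hπx : π x = 0) (s : ℕ → S) (N : ℕ → ℕ) (I : Finset ℕ)
    (hN : ∀ i ∈ I, ((p : ℤ) ^ N i) • s i = 0)
    (hindQ : ∀ (α β : ℕ → ℤ), ∑ i ∈ I, (α i • π (s i) + β i • w' (π (s i))) = 0 →
      ∀ i ∈ I, ((p : ℤ) ^ N i) ∣ α i ∧ ((p : ℤ) ^ N i) ∣ β i)
    (b c : ℤ) (α β : ℕ → ℤ)
    (h : (b • x + c • w x) + ∑ i ∈ I, (α i • s i + β i • w (s i)) = 0) :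
    b • x + c • w x = 0 ∧ ∀ i ∈ I, α i • s i + β i • w (s i) = 0 := by
  -- apply `π`: the `x`-terms die, the `s`-terms become a relation among the images
  have hπ := congrArg π h
  rw [map_add, map_add, map_zsmul, map_zsmul, hπw x, hπx, map_zero, smul_zero, smul_zero, add_zero,
    zero_add, map_sum, map_zero] at hπ
  simp only [map_add, map_zsmul, hπw] at hπ
  have hterms : ∀ i ∈ I, α i • s i + β i • w (s i) = 0 := fun i hi ↦
    zsmul_add_zsmul_eq_zero_of_dvd w (hN i hi) (hindQ α β hπ i hi).1 (hindQ α β hπ i hi).2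
  refine ⟨?_, hterms⟩
  rw [Finset.sum_eq_zero hterms, add_zero] at h
  exact h

/-- **Transfer of `𝒪`-independence from the images, `x`-free form** — the telescope's `hindA`.
[cite: McCallumLMS1991, §5 (p. 288)] -/
theorem indep_of_indep_image' {p : ℕ} (π : S →+ Q) (w : S →+ S) (w' : Q →+ Q)
    (hπw : ∀ s, π (w s) = w' (π s)) (s : ℕ → S) (N : ℕ → ℕ) (I : Finset ℕ)
    (hN : ∀ i ∈ I, ((p : ℤ) ^ N i) • s i = 0)
    (hindQ : ∀ (α β : ℕ → ℤ), ∑ i ∈ I, (α i • π (s i) + β i • w' (π (s i))) = 0 →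
      ∀ i ∈ I, ((p : ℤ) ^ N i) ∣ α i ∧ ((p : ℤ) ^ N i) ∣ β i)
    (α β : ℕ → ℤ) (h : ∑ i ∈ I, (α i • s i + β i • w (s i)) = 0) :
    ∀ i ∈ I, α i • s i + β i • w (s i) = 0 := by
  have h' : ((0 : ℤ) • (0 : S) + (0 : ℤ) • w 0) + ∑ i ∈ I, (α i • s i + β i • w (s i)) = 0 := by
    simpa using h
  exact (indep_of_indep_image π w w' hπw 0 (map_zero π) s N I hN hindQ 0 0 α β h').2

/-- **Exactness of the lifts' orders** — the telescope's `hN'`: if the images are `𝒪`-independent with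
exact annihilators `p^{N i}`, then `N k ≠ 0 ⟹ p^{N k - 1} s_k ≠ 0` for `k ∈ I`. [folklore] -/
theorem pow_sub_one_smul_ne_zero_of_indep_image {p : ℕ} (hp : p.Prime) (π : S →+ Q) (w' : Q →+ Q)
    (s : ℕ → S) (N : ℕ → ℕ) (I : Finset ℕ)
    (hindQ : ∀ (α β : ℕ → ℤ), ∑ i ∈ I, (α i • π (s i) + β i • w' (π (s i))) = 0 →
      ∀ i ∈ I, ((p : ℤ) ^ N i) ∣ α i ∧ ((p : ℤ) ^ N i) ∣ β i)
    {k : ℕ} (hk : k ∈ I) (hNk : N k ≠ 0) : ((p : ℤ) ^ (N k - 1)) • s k ≠ 0 := by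
  intro h0
  have hrel : ∑ i ∈ I, ((if i = k then (p : ℤ) ^ (N k - 1) else 0) • π (s i) +
      (0 : ℤ) • w' (π (s i))) = 0 := by
    simp only [zero_smul, add_zero, ite_smul, Finset.sum_ite_eq', hk, if_true, ← map_zsmul, h0,
      map_zero]
  have hdvd := (hindQ _ (fun _ ↦ 0) hrel k hk).1
  simp only [if_true] at hdvd
  -- `p^{N k} ∣ p^{N k - 1}` is impossible for a prime `p`
  have hlt : (p : ℤ) ^ (N k - 1) < (p : ℤ) ^ N k :=
    pow_lt_pow_right₀ (by exact_mod_cast hp.one_lt) (by omega)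
  have hpos : (0 : ℤ) < (p : ℤ) ^ (N k - 1) := pow_pos (by exact_mod_cast hp.pos) _
  exact not_lt.mpr (Int.le_of_dvd hpos hdvd) hlt

/-- **`𝒪`-independence with exact annihilators from a `ℤ`-basis through the descent** (LEMMA K0 /
LEMMA D: `D₀ ⊔ w'·D₀ ≅ D₀ ⊗ 𝒪`): if the `d i` (`i ∈ I`) lie in a subgroup `D₀` on which
`(a, b) ↦ a + w' b` is injective and are `ℤ`-independent with exact orders `p^{N i}`
(`∑ γ_i d_i = 0 ⟹ p^{N i} ∣ γ_i`), then `∑ (α_i d_i + β_i w' d_i) = 0 ⟹ p^{N_i} ∣ α_i, β_i`.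
[cite: McCallumLMS1991, §5 (p. 288)] -/
theorem indep_image_of_descent {p : ℕ} (w' : Q →+ Q) (D₀ : AddSubgroup Q)
    (hdesc : ∀ a ∈ D₀, ∀ b ∈ D₀, a + w' b = 0 → a = 0 ∧ b = 0) (d : ℕ → Q) (N : ℕ → ℕ)
    (I : Finset ℕ) (hd : ∀ i ∈ I, d i ∈ D₀)
    (hindZ : ∀ γ : ℕ → ℤ, ∑ i ∈ I, γ i • d i = 0 → ∀ i ∈ I, ((p : ℤ) ^ N i) ∣ γ i)
    (α β : ℕ → ℤ) (h : ∑ i ∈ I, (α i • d i + β i • w' (d i)) = 0) :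
    ∀ i ∈ I, ((p : ℤ) ^ N i) ∣ α i ∧ ((p : ℤ) ^ N i) ∣ β i := by
  have hsplit : ∑ i ∈ I, (α i • d i + β i • w' (d i)) =
      (∑ i ∈ I, α i • d i) + w' (∑ i ∈ I, β i • d i) := by
    rw [map_sum, ← Finset.sum_add_distrib]
    refine Finset.sum_congr rfl fun i _ ↦ ?_
    rw [map_zsmul]
  rw [hsplit] at h
  have hmemα : ∑ i ∈ I, α i • d i ∈ D₀ :=
    AddSubgroup.sum_mem _ fun i hi ↦ AddSubgroup.zsmul_mem _ (hd i hi) _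
  have hmemβ : ∑ i ∈ I, β i • d i ∈ D₀ :=
    AddSubgroup.sum_mem _ fun i hi ↦ AddSubgroup.zsmul_mem _ (hd i hi) _
  obtain ⟨hα, hβ⟩ := hdesc _ hmemα _ hmemβ h
  exact fun i hi ↦ ⟨hindZ α hα i hi, hindZ β hβ i hi⟩

end Lifts

end Summit.BirchSwinnertonDyer.BirchSwinnertonDyer.Theorems.SylvesterTwoCoupledTelescope
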